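import Literature.MathematicalPhysics.QuantumFieldTheory.WilsonPartitionResolutionForm
import Literature.Analysis.Asymptotics.SublevelChartPieces
import Literature.Analysis.Calculus.ResolutionChartSum
import HarnessLib

/-!
# `WilsonPartitionRegularVariation` from Hironaka's resolution of singularities (as printed)

The last reduction of the named fact `WilsonPartitionRegularVariation`: its only remaining
hypothesis is now **Hironaka's theorem itself, in the printed real-analytic, local, simultaneous
form** — Watanabe 2009, Theorem 2.8 (simultaneous resolution of singularities) = Lin 2017,
Theorem 2.2 with Corollary 2.3 = Arnold–Gusein-Zade–Varchenko II, Part II §6.3, Theorem 6.6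
(Hironaka [158]; Atiyah 1970 / Bernstein–Gelfand 1969 [32]) for one function: for real-analytic
`F₁, …, F_l` on a connected open neighbourhood `V` of `0 ∈ ℝ^d`, vanishing at `0` and not
constant, there are an open `W ∋ 0` in `V`, a real-analytic manifold `M` and a proper real-analytic
map `g : M → W` which is an isomorphism off the zero sets and such that every point of the zero
set has an analytic coordinate neighbourhood centred at it in which each `Fᵢ ∘ g` is `aᵢ(u) u^{kᵢ}`
and the Jacobian determinant of `g` is `b(u) u^h` with analytic units `aᵢ, b`. That statement —
`hR` below, written with Mathlib's manifold library (`ChartedSpace`, `IsManifold 𝓘(ℝ, ℝ^d) ω`,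
`IsManifold.maximalAtlas`, `ContMDiff … ω`) — is the binder of the two theorems of this file;
it is NOT proved in the tree (no resolution of singularities in Mathlib) and is not restated as a
named fact here (D-0026). Granted it:

* `localMonomialization_of_resolution` PROVES the local monomialization hypothesis `hH` of
  `wilsonPartitionRegularVariation_of_localMonomialization` (Lin 2017, proof of Lemma 2.4) from it:
  reduction to `ℝ^d` by a linear isomorphism and a translation (Haar measure = constant · Lebesgue),
  the degenerate case `f ≡ 0` near the point, selection of the boundary inequalities that are active
  and non-trivial at the point (the others are automatic nearby; the resolved family is
  `(f, g_j or f)`), the chart sum of the resolution (`Resolution.exists_chartSum`: fibre compactness,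
  partition of unity, change of variables chart by chart, null zero sets) and the orthant pieces of
  each chart (`MonomialPhase.chartIntegral_eq_sum_pieces`);
* `wilsonPartitionRegularVariation_of_resolutionOfSingularities` is the named fact from `hR` alone;
* `resolutionHypothesis_shape_example` inhabits the conclusion block of `hR` in the trivial case
  `d = l = 1`, `F₀(v) = v₀` (a shape / non-vacuity witness, not the theorem).

## References

* S. Watanabe, *Algebraic Geometry and Statistical Learning Theory*, CUP (2009), Thm. 2.8, Thm. 2.3.
  [WatanabeSumio2009]
* S. Lin, arXiv:1003.5338, Thm. 2.2, Cor. 2.3, Lemma 2.4. [Lin2017]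
* V. I. Arnold, S. M. Gusein-Zade, A. N. Varchenko, *Singularities of Differentiable Maps II*
  (2012), Part II §6.3 Thm. 6.6, §7.3 Thms. 7.5, 7.6. [ArnoldGuseinzadeVarchenko2012]
* H. Hironaka, *Resolution of singularities of an algebraic variety over a field of characteristic
  zero I, II*, Ann. of Math. 79 (1964). [Hironaka1964]
-/

noncomputable section

open Set Filter Metric Function
open _root_.MeasureTheory _root_.Topology
open Literature.Analysis.Asymptotics Literature.Analysis.Asymptotics.MonomialPhase
open Literature.Analysis.Calculus Literature.Analysis.Calculus.Resolution
open scoped ENNReal ContDiff Manifold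

namespace Literature.MathematicalPhysics.QuantumFieldTheory

section Transport

variable {E : Type*} [NormedAddCommGroup E] [NormedSpace ℝ E] [MeasurableSpace E] [BorelSpace E]

/-- **An additive Haar measure read in affine coordinates is a constant multiple of Lebesgue
measure**: for a linear isomorphism `T : E ≃L ℝ^D` and a base point `x`, there is `c > 0` with
`∫ G dμ = c ∫ G(x + T⁻¹ v) dv` for every `G : E → ℝ`. [folklore] -/
theorem exists_integral_eq_const_mul_integral_affine (μ : Measure E) [μ.IsAddHaarMeasure]
    {D : ℕ} (T : E ≃L[ℝ] (Fin D → ℝ)) (x : E) :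
    ∃ c : ℝ, 0 < c ∧ ∀ G : E → ℝ, ∫ z, G z ∂μ = c * ∫ v, G (x + T.symm v) := by
  -- the affine homeomorphism `z ↦ T (-x + z)` and the image measure
  set Φ : E ≃ₜ (Fin D → ℝ) := (Homeomorph.addLeft (-x)).trans T.toHomeomorph with hΦ
  have hΦapply : ∀ z, Φ z = T (-x + z) := fun z => rfl
  have hΦsymm : ∀ v, Φ.symm v = x + T.symm v := fun v => by
    apply Φ.injective
    rw [Φ.apply_symm_apply, hΦapply, ← add_assoc, neg_add_cancel, zero_add,
      ContinuousLinearEquiv.apply_symm_apply]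
  set ν : Measure (Fin D → ℝ) := μ.map Φ with hν
  have hν' : ν = (μ.map fun z => -x + z).map T := by
    rw [hν, show (Φ : E → Fin D → ℝ) = (T : E → Fin D → ℝ) ∘ fun z => -x + z from
      funext hΦapply, Measure.map_map T.continuous.measurable (measurable_const_add _)]
  haveI : ν.IsAddHaarMeasure := by
    rw [hν', map_add_left_eq_self]
    exact T.isAddHaarMeasure_map μ
  -- `ν = c • volume`
  set K₀ : TopologicalSpace.PositiveCompacts (Fin D → ℝ) := TopologicalSpace.PositiveCompacts.piIcc01 (Fin D)
  have hνeq : ν = ν K₀ • (volume : Measure (Fin D → ℝ)) := by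
    have h1 := Measure.addHaarMeasure_unique ν K₀
    rwa [addHaarMeasure_eq_volume_pi] at h1
  have hK₀pos : 0 < ν K₀ := Measure.measure_pos_of_nonempty_interior ν K₀.interior_nonempty
  have hK₀top : ν K₀ < ⊤ := K₀.isCompact.measure_lt_top
  refine ⟨(ν K₀).toReal, ENNReal.toReal_pos hK₀pos.ne' hK₀top.ne, fun G => ?_⟩
  have hmap : ∫ z, G z ∂μ = ∫ v, G (Φ.symm v) ∂ν := by
    rw [hν, ← Homeomorph.toMeasurableEquiv_coe, integral_map_equiv]
    simp only [Homeomorph.toMeasurableEquiv_coe, Homeomorph.symm_apply_apply]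
  rw [hmap]
  calc ∫ v, G (Φ.symm v) ∂ν
      = ∫ v, G (Φ.symm v) ∂((ν K₀) • (volume : Measure (Fin D → ℝ))) := by rw [← hνeq]
    _ = (ν K₀).toReal * ∫ v, G (Φ.symm v) := by rw [integral_smul_measure, smul_eq_mul]
    _ = (ν K₀).toReal * ∫ v, G (x + T.symm v) := by
        congr 1
        exact integral_congr_ae (ae_of_all _ fun v => by simp only [hΦsymm])

end Transport

section Measurability

variable {E : Type*} [TopologicalSpace E] [MeasurableSpace E] [OpensMeasurableSpace E]

/-- A function continuous on an open set, extended by `0`, is Borel measurable. [folklore] -/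
theorem measurable_indicator_of_continuousOn {U : Set E} (hU : IsOpen U) {φ : E → ℝ}
    (hφ : ContinuousOn φ U) : Measurable (U.indicator φ) := by
  refine measurable_of_isOpen fun O hO => ?_
  by_cases h0 : (0 : ℝ) ∈ O
  · have : U.indicator φ ⁻¹' O = (U ∩ φ ⁻¹' O) ∪ Uᶜ := by
      ext z
      by_cases hz : z ∈ U
      · simp [hz]
      · simp [hz, h0]
    rw [this]
    exact (hφ.isOpen_inter_preimage hU hO).measurableSet.union hU.measurableSet.compl
  · have : U.indicator φ ⁻¹' O = U ∩ φ ⁻¹' O := by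
      ext z
      by_cases hz : z ∈ U
      · simp [hz]
      · simp [hz, h0]
    rw [this]
    exact (hφ.isOpen_inter_preimage hU hO).measurableSet

end Measurability

section Main

set_option maxHeartbeats 3200000 in
-- one long assembly proof: reductions (coordinates, translation, degenerate case, active
-- constraints), Hironaka, chart sum, orthant pieces, bookkeeping of the Σ-indexed family
/-- **Local monomialization of weighted sublevel integrals from Hironaka's theorem.** The
hypothesis `hH` of `wilsonPartitionRegularVariation_of_localMonomialization` — at a zero `x ∈ Ω`
of the analytic `f` over the compact semianalytic `Ω = {g_j ≥ 0} ⊆ U` with `μ(Ω ∩ f⁻¹0) = 0`, a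
neighbourhood `W ∋ x` over which all `σφ`-weighted sublevel integrals of `|f|` are finite sums of
monomial pieces over the unit cube — PROVED from the printed statement `hR` of the simultaneous
resolution of singularities (Watanabe 2009 Thm. 2.8; Lin 2017 Thm. 2.2/Cor. 2.3; AGV II Part II
§6.3 Thm. 6.6), following Lin 2017, proof of Lemma 2.4. `hR` is NOT proved in the tree.
[cite: Lin2017, Thm. 2.2, Cor. 2.3, proof of Lemma 2.4] [cite: WatanabeSumio2009, Thm. 2.8]
[cite: ArnoldGuseinzadeVarchenko2012, Part II §6.3 Thm. 6.6, §7.3 proof of Thm. 7.5] -/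
theorem localMonomialization_of_resolution
    (hR : ∀ (d l : ℕ) (V : Set (Fin d → ℝ)) (F : Fin l → (Fin d → ℝ) → ℝ),
      IsOpen V → IsPreconnected V → (0 : Fin d → ℝ) ∈ V →
      (∀ i, AnalyticOnNhd ℝ (F i) V) → (∀ i, F i 0 = 0) → (∀ i, ∃ v ∈ V, F i v ≠ 0) →
      ∃ (W : Set (Fin d → ℝ)) (M : Type) (_ : TopologicalSpace M) (_ : T2Space M)
        (_ : ChartedSpace (Fin d → ℝ) M) (_ : IsManifold 𝓘(ℝ, Fin d → ℝ) ω M)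
        (g : M → (Fin d → ℝ)),
        IsOpen W ∧ (0 : Fin d → ℝ) ∈ W ∧ W ⊆ V ∧ (∀ p, g p ∈ W) ∧
        ContMDiff 𝓘(ℝ, Fin d → ℝ) 𝓘(ℝ, Fin d → ℝ) ω g ∧
        (∀ K ⊆ W, IsCompact K → IsCompact (g ⁻¹' K)) ∧
        Set.BijOn g {p | ∀ i, F i (g p) ≠ 0} {x ∈ W | ∀ i, F i x ≠ 0} ∧
        ∀ p : M, (∃ i, F i (g p) = 0) →
          ∃ φ : OpenPartialHomeomorph M (Fin d → ℝ),
            φ ∈ IsManifold.maximalAtlas 𝓘(ℝ, Fin d → ℝ) ω M ∧ p ∈ φ.source ∧ φ p = 0 ∧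
            ∃ (k : Fin l → Fin d → ℕ) (h : Fin d → ℕ) (a : Fin l → (Fin d → ℝ) → ℝ)
              (b : (Fin d → ℝ) → ℝ),
              (∀ i, AnalyticOnNhd ℝ (a i) φ.target) ∧ AnalyticOnNhd ℝ b φ.target ∧
              (∀ i, ∀ u ∈ φ.target, a i u ≠ 0) ∧ (∀ u ∈ φ.target, b u ≠ 0) ∧
              (∀ i, ∀ u ∈ φ.target, F i (g (φ.symm u)) = a i u * ∏ j, u j ^ k i j) ∧
              (∀ u ∈ φ.target, (fderiv ℝ (g ∘ φ.symm) u).det = b u * ∏ j, u j ^ h j)) :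
    ∀ (E : Type) [NormedAddCommGroup E] [NormedSpace ℝ E] [FiniteDimensional ℝ E]
      [MeasurableSpace E] [BorelSpace E] (μ : Measure E) [μ.IsAddHaarMeasure],
      ∀ (U : Set E) (f : E → ℝ) (l : ℕ) (g : Fin l → E → ℝ) (φ : E → ℝ),
        IsOpen U → AnalyticOnNhd ℝ f U → (∀ j, AnalyticOnNhd ℝ (g j) U) → ContDiffOn ℝ ∞ φ U →
        IsCompact {x ∈ U | ∀ j, 0 ≤ g j x} → (∀ x ∈ {x ∈ U | ∀ j, 0 ≤ g j x}, 0 < φ x) →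
        μ {x ∈ U | (∀ j, 0 ≤ g j x) ∧ f x = 0} = 0 →
        ∀ x ∈ {x ∈ U | ∀ j, 0 ≤ g j x}, f x = 0 → ∃ W : Set E, IsOpen W ∧ x ∈ W ∧
          ∃ (ι : Type) (_ : Fintype ι) (κ w : ι → Fin (Module.finrank ℝ E) → ℕ)
            (a ψ : ι → (Fin (Module.finrank ℝ E) → ℝ) → ℝ)
            (P : ι → (Fin (Module.finrank ℝ E) → ℝ) → E),
            (∀ k, κ k ≠ 0) ∧ (∀ k j, 0 < w k j) ∧ (∀ k, Continuous (a k)) ∧ (∀ k y, 0 < a k y) ∧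
            (∀ k, Continuous (ψ k)) ∧
            (∀ k, ∀ y ∈ Icc (0 : Fin (Module.finrank ℝ E) → ℝ) 1, 0 ≤ ψ k y) ∧
            (∀ k, 0 < ψ k 0) ∧ (∀ k, Continuous (P k)) ∧ (∀ k, P k 0 = x) ∧
            ∀ σ : E → ℝ, Continuous σ → tsupport σ ⊆ W → (∀ z, 0 ≤ σ z) → ∀ t : ℝ, 0 < t →
              ∫ z in {z ∈ {x ∈ U | ∀ j, 0 ≤ g j x} | |f z| ≤ t}, σ z * φ z ∂μ =
                ∑ k, ∫ y in {y : Fin (Module.finrank ℝ E) → ℝ | a k y * ∏ j, y j ^ κ k j ≤ t},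
                  σ (P k y) * ψ k y ∂(Measure.pi fun j => powMeasure (w k j : ℝ)) := by
  intro E _ _ _ _ _ μ _ U f l g φ hU hf hg hφ hΩc hφpos hnull x hx hfx
  classical
  set D : ℕ := Module.finrank ℝ E with hDdef
  have hxU : x ∈ U := hx.1
  have hgx : ∀ j, 0 ≤ g j x := hx.2
  have hΩU : {x ∈ U | ∀ j, 0 ≤ g j x} ⊆ U := fun z hz => hz.1
  have hAm : ∀ t, MeasurableSet {z ∈ {x ∈ U | ∀ j, 0 ≤ g j x} | |f z| ≤ t} := fun t =>
    ((continuous_abs.comp_continuousOn (hf.continuousOn.mono hΩU)).preimage_isClosed_of_isClosed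
      hΩc.isClosed isClosed_Iic (t := Iic t)).measurableSet
  have hN : ∀ᵐ z ∂μ, z ∉ {x ∈ U | (∀ j, 0 ≤ g j x) ∧ f x = 0} :=
    measure_eq_zero_iff_ae_notMem.1 hnull
  ------------------------------------------------------------------
  -- Case 1: `f ≡ 0` near `x`: the empty family
  ------------------------------------------------------------------
  by_cases hzero : ∀ᶠ z in 𝓝 x, f z = 0
  · obtain ⟨W, hWf, hWo, hxW⟩ := _root_.eventually_nhds_iff.1 hzero
    refine ⟨W, hWo, hxW, PEmpty, inferInstance, fun k => k.elim, fun k => k.elim, fun k => k.elim,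
      fun k => k.elim, fun k => k.elim, fun k => k.elim, fun k => k.elim, fun k => k.elim,
      fun k => k.elim, fun k => k.elim, fun k => k.elim, fun k => k.elim, fun k => k.elim,
      fun k => k.elim, fun σ hσc hσW hσ0 t ht => ?_⟩
    rw [Fintype.sum_empty]
    refine integral_eq_zero_of_ae ?_
    filter_upwards [ae_restrict_mem (hAm t), ae_restrict_of_ae hN] with z hzA hzN
    show σ z * φ z = 0
    by_contra hne
    have hσz : σ z ≠ 0 := left_ne_zero_of_mul hne
    have hzW : z ∈ W := hσW (subset_tsupport _ hσz)
    exact hzN ⟨hzA.1.1, hzA.1.2, hWf z hzW⟩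
  ------------------------------------------------------------------
  -- Case 2: `f ≢ 0` near `x`
  ------------------------------------------------------------------
  -- the active, non-trivial boundary inequalities at `x`
  set J : Finset (Fin l) := Finset.univ.filter fun j => g j x = 0 ∧ ¬ ∀ᶠ z in 𝓝 x, g j z = 0
    with hJ
  have hJmem : ∀ j, j ∈ J ↔ g j x = 0 ∧ ¬ ∀ᶠ z in 𝓝 x, g j z = 0 := fun j => by simp [hJ]
  have hauto : ∀ᶠ z in 𝓝 x, ∀ j, j ∉ J → 0 ≤ g j z := by
    rw [eventually_all]
    intro j
    by_cases hj : j ∈ J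
    · exact Eventually.of_forall fun z hj' => (hj' hj).elim
    · rw [hJmem, not_and_or] at hj
      rcases hj with hj | hj
      · have hpos : 0 < g j x := lt_of_le_of_ne (hgx j) (Ne.symm hj)
        have hc : ContinuousAt (g j) x := (hg j x hxU).continuousAt
        filter_upwards [hc.preimage_mem_nhds (Ioi_mem_nhds hpos)] with z hz _
        exact le_of_lt hz
      · push Not at hj
        filter_upwards [hj] with z hz _
        exact hz.ge
  obtain ⟨r₀, hr₀, hball⟩ : ∃ r₀ > 0, ball x r₀ ⊆ U ∩ {z | ∀ j, j ∉ J → 0 ≤ g j z} :=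
    Metric.mem_nhds_iff.1 (inter_mem (hU.mem_nhds hxU) hauto)
  have hballU : ball x r₀ ⊆ U := fun z hz => (hball hz).1
  have hballJ : ∀ z ∈ ball x r₀, ∀ j, j ∉ J → 0 ≤ g j z := fun z hz => (hball hz).2
  -- affine coordinates `Ψ v = x + T⁻¹ v`
  set T : E ≃L[ℝ] (Fin D → ℝ) := (Module.finBasis ℝ E).equivFun.toContinuousLinearEquiv with hT
  set Ψ : (Fin D → ℝ) → E := fun v => x + T.symm v with hΨ
  have hΨc : Continuous Ψ := continuous_const.add T.symm.continuous
  have hΨ0 : Ψ 0 = x := by simp [hΨ]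
  have hΨan : AnalyticOnNhd ℝ Ψ univ := fun v _ =>
    analyticAt_const.add ((T.symm : (Fin D → ℝ) →L[ℝ] E).analyticAt v)
  have hΨinv : ∀ z, Ψ (T (z - x)) = z := fun z => by simp [hΨ]
  have hTΨ : ∀ v, T (Ψ v - x) = v := fun v => by simp [hΨ]
  set V : Set (Fin D → ℝ) := Ψ ⁻¹' ball x r₀ with hV
  have hVo : IsOpen V := isOpen_ball.preimage hΨc
  have h0V : (0 : Fin D → ℝ) ∈ V := by
    show Ψ 0 ∈ ball x r₀; rw [hΨ0]; exact mem_ball_self hr₀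
  have hVeq : V = (T.symm : (Fin D → ℝ) → E) ⁻¹' ball 0 r₀ := by
    ext v; simp [hV, hΨ, dist_eq_norm]
  have hVc : IsPreconnected V := by
    rw [hVeq]
    exact ((convex_ball (0 : E) r₀).linear_preimage
      (T.symm.toLinearEquiv : (Fin D → ℝ) →ₗ[ℝ] E)).isPreconnected
  have hVU : ∀ v ∈ V, Ψ v ∈ U := fun v hv => hballU hv
  have hVU' : MapsTo Ψ V U := fun v hv => hVU v hv
  -- the resolved family `(f, g_j or f) ∘ Ψ`
  set Fam : Fin (l + 1) → (Fin D → ℝ) → ℝ :=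
    Fin.cons (fun v => f (Ψ v)) (fun j v => if j ∈ J then g j (Ψ v) else f (Ψ v)) with hFam
  have hFam0 : ∀ v, Fam 0 v = f (Ψ v) := fun v => by simp [hFam]
  have hFamJ : ∀ j ∈ J, ∀ v, Fam j.succ v = g j (Ψ v) := fun j hj v => by simp [hFam, hj]
  have hFamJ' : ∀ j, j ∉ J → ∀ v, Fam j.succ v = f (Ψ v) := fun j hj v => by simp [hFam, hj]
  have hfΨ : AnalyticOnNhd ℝ (fun v => f (Ψ v)) V := hf.comp (hΨan.mono (subset_univ _)) hVU'
  have hFan : ∀ i, AnalyticOnNhd ℝ (Fam i) V := by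
    refine Fin.cases ?_ (fun j => ?_)
    · have : Fam 0 = fun v => f (Ψ v) := funext hFam0
      rw [this]; exact hfΨ
    · by_cases hj : j ∈ J
      · have : Fam j.succ = fun v => g j (Ψ v) := funext (hFamJ j hj)
        rw [this]; exact (hg j).comp (hΨan.mono (subset_univ _)) hVU'
      · have : Fam j.succ = fun v => f (Ψ v) := funext (hFamJ' j hj)
        rw [this]; exact hfΨ
  have hFa0 : ∀ i, Fam i 0 = 0 := by
    refine Fin.cases ?_ (fun j => ?_)
    · rw [hFam0, hΨ0, hfx]
    · by_cases hj : j ∈ J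
      · rw [hFamJ j hj, hΨ0]; exact ((hJmem j).1 hj).1
      · rw [hFamJ' j hj, hΨ0, hfx]
  have hnc : ∀ q : E → ℝ, (¬ ∀ᶠ z in 𝓝 x, q z = 0) → ∃ v ∈ V, q (Ψ v) ≠ 0 := by
    intro q hq
    by_contra hall
    push Not at hall
    apply hq
    filter_upwards [isOpen_ball.mem_nhds (mem_ball_self hr₀)] with z hz
    have := hall (T (z - x)) (by show Ψ (T (z - x)) ∈ ball x r₀; rw [hΨinv]; exact hz)
    rwa [hΨinv] at this
  have hFne : ∀ i, ∃ v ∈ V, Fam i v ≠ 0 := by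
    refine Fin.cases ?_ (fun j => ?_)
    · simp only [hFam0]; exact hnc f hzero
    · by_cases hj : j ∈ J
      · simp only [hFamJ j hj]; exact hnc (g j) ((hJmem j).1 hj).2
      · simp only [hFamJ' j hj]; exact hnc f hzero
  -- Hironaka, the chart sum, the orthant pieces
  obtain ⟨W, M, _, _, _, _, gres, hWo, h0W, hWV, hgW, hgan, hprop, hbij, hchart⟩ :=
    hR D (l + 1) V Fam hVo hVc h0V hFan hFa0 hFne
  obtain ⟨r, hr, hrW, ι, _, δ, Pm, k, h, A, Jf, wt, hδ, hPmc, hPm0, hPmW, hAc, hA0, hJc, hJpos,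
    hwtc, hwt0, hwtpos, hmono, hsum⟩ :=
    exists_chartSum hVo hVc hFan hFne 0 (hFa0 0) hWo h0W hWV hgW hgan hprop hbij hchart
  have hPmU : ∀ n u, Ψ (Pm n u) ∈ U := fun n u => hVU _ (hWV (hPmW n u))
  have hPmball : ∀ n u, Ψ (Pm n u) ∈ ball x r₀ := fun n u => hWV (hPmW n u)
  set ρ : ι → (Fin D → ℝ) → ℝ := fun n u => max (φ (Ψ (Pm n u))) 0 * (wt n u * Jf n u) with hρ
  have hρc : ∀ n, Continuous (ρ n) := fun n =>
    ((hφ.continuousOn.comp_continuous (hΨc.comp (hPmc n)) (hPmU n)).max continuous_const).mul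
      ((hwtc n).mul (hJc n))
  have hρ0 : ∀ n u, 0 ≤ ρ n u := fun n u =>
    mul_nonneg (le_max_right _ _) (mul_nonneg (hwt0 n u) (hJpos n u).le)
  have hρpos : ∀ n, 0 < ρ n 0 := fun n => by
    simp only [hρ, hPm0, hΨ0]
    exact mul_pos (lt_max_of_lt_left (hφpos x hx)) (mul_pos (hwtpos n) (hJpos n 0))
  have hpieces := fun n : ι => chartIntegral_eq_sum_pieces (β := ↥J) (hδ n) (k n 0) (h n)
    (fun b => k n (Fin.succ b)) (af := A n 0) (ρ := ρ n) (aj := fun b => A n (Fin.succ b))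
    (hAc n 0) (hA0 n 0) (fun b => hAc n _) (fun b u => hA0 n _ u) (hρc n) (hρ0 n) (hρpos n)
  choose ιn instn An ψn Sn hAnc hAnpos hψnc hψn0 hψnpos hSnc hSn0 hSnδ hidn using hpieces
  letI : ∀ n, Fintype (ιn n) := instn
  obtain ⟨c, hc, hcint⟩ := exists_integral_eq_const_mul_integral_affine μ T x
  -- the neighbourhood and the Σ-indexed family of pieces
  set WE : Set E := {z | ‖T (z - x)‖ < r} with hWE
  have hWEo : IsOpen WE :=
    isOpen_lt (continuous_norm.comp (T.continuous.comp (continuous_id.sub continuous_const)))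
      continuous_const
  have hxWE : x ∈ WE := by simp [hWE, hr]
  have hk0 : ∀ n, k n 0 ≠ 0 := by
    intro n hk
    have h1 := hmono n 0 0 (by rw [norm_zero]; exact (hδ n).le)
    rw [hPm0, hFa0] at h1
    have : ∏ j, (0 : Fin D → ℝ) j ^ k n 0 j = 1 :=
      Finset.prod_eq_one fun j _ => by rw [show k n 0 j = 0 from congr_fun hk j, pow_zero]
    rw [this, mul_one] at h1
    exact hA0 n 0 0 h1.symm
  refine ⟨WE, hWEo, hxWE, (Σ n, ιn n), inferInstance, fun p => k p.1 0, fun p j => h p.1 j + 1,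
    fun p => An p.1 p.2, fun p y => c * ψn p.1 p.2 y, fun p y => Ψ (Pm p.1 (Sn p.1 p.2 y)),
    fun p => hk0 p.1, fun p j => Nat.succ_pos _, fun p => hAnc p.1 p.2, fun p y => hAnpos p.1 p.2 y,
    fun p => continuous_const.mul (hψnc p.1 p.2), fun p y _ => mul_nonneg hc.le (hψn0 p.1 p.2 y),
    fun p => mul_pos hc (hψnpos p.1 p.2), fun p => hΨc.comp ((hPmc p.1).comp (hSnc p.1 p.2)),
    fun p => by simp only [hSn0, hPm0, hΨ0], ?_⟩
  -- the identity
  intro σ hσc hσW hσ0 t ht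
  set Aset : Set E := {z ∈ {x ∈ U | ∀ j, 0 ≤ g j x} | |f z| ≤ t} with hAset
  -- (i) a measurable integrand on `E`
  set φm : E → ℝ := U.indicator φ with hφm
  have hφmeas : Measurable φm := measurable_indicator_of_continuousOn hU hφ.continuousOn
  have hφmU : ∀ z ∈ U, φm z = φ z := fun z hz => indicator_of_mem hz _
  set Gt : E → ℝ := Aset.indicator fun z => σ z * φm z with hGt
  have hGtm : Measurable Gt := (hσc.measurable.mul hφmeas).indicator (hAm t)
  have hLHS : ∫ z in Aset, σ z * φ z ∂μ = ∫ z, Gt z ∂μ := by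
    rw [hGt, integral_indicator (hAm t)]
    exact setIntegral_congr_fun (hAm t) fun z hz => by rw [hφmU z hz.1.1]
  obtain ⟨Bσ, hBσ⟩ := hΩc.exists_bound_of_continuousOn hσc.continuousOn
  obtain ⟨Bφ, hBφ⟩ := hΩc.exists_bound_of_continuousOn (hφ.continuousOn.mono hΩU)
  have hBσ0 : 0 ≤ Bσ := le_trans (norm_nonneg _) (hBσ x hx)
  have hBφ0 : 0 ≤ Bφ := le_trans (norm_nonneg _) (hBφ x hx)
  have hGtbd : ∀ z, |Gt z| ≤ Bσ * Bφ := by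
    intro z
    by_cases hz : z ∈ Aset
    · rw [hGt, indicator_of_mem hz, hφmU z hz.1.1, abs_mul]
      exact mul_le_mul (by simpa only [Real.norm_eq_abs] using hBσ z hz.1)
        (by simpa only [Real.norm_eq_abs] using hBφ z hz.1) (abs_nonneg _) hBσ0
    · rw [hGt, indicator_of_notMem hz, abs_zero]; exact mul_nonneg hBσ0 hBφ0
  -- (ii)+(iii) transport to `ℝ^D` and the chart sum
  set G : (Fin D → ℝ) → ℝ := fun v => Gt (Ψ v) with hG
  have hGm : Measurable G := hGtm.comp hΨc.measurable
  have hGsupp : ∀ v, G v ≠ 0 → ‖v‖ < r := by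
    intro v hv
    have h1 : σ (Ψ v) ≠ 0 := by
      intro h0; apply hv
      simp only [hG, hGt]
      by_cases hA : Ψ v ∈ Aset
      · rw [indicator_of_mem hA, h0, zero_mul]
      · rw [indicator_of_notMem hA]
    have h2 : Ψ v ∈ WE := hσW (subset_tsupport _ h1)
    have h3 : ‖T (Ψ v - x)‖ < r := h2
    rwa [hTΨ] at h3
  have hchain : ∫ z, Gt z ∂μ = c * ∑ n, ∫ u in ball (0 : Fin D → ℝ) (δ n),
      G (Pm n u) * (wt n u * (Jf n u * ∏ j, |u j| ^ h n j)) := by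
    rw [hcint Gt]
    exact congrArg (c * ·) (hsum G hGm ⟨Bσ * Bφ, fun v => hGtbd _⟩ hGsupp)
  -- (iv) each chart integral in normal-crossing form
  have hchartform : ∀ n, ∫ u in ball (0 : Fin D → ℝ) (δ n),
      G (Pm n u) * (wt n u * (Jf n u * ∏ j, |u j| ^ h n j)) =
      ∫ u in {u ∈ ball (0 : Fin D → ℝ) (δ n) |
          (∀ b : ↥J, 0 ≤ A n (Fin.succ b) u * ∏ j, u j ^ k n (Fin.succ b) j) ∧
          |A n 0 u * ∏ j, u j ^ k n 0 j| ≤ t},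
        σ (Ψ (Pm n u)) * ρ n u * ∏ j, |u j| ^ h n j := by
    intro n
    set Cn : Set (Fin D → ℝ) :=
      {u | ∀ b : ↥J, 0 ≤ A n (Fin.succ b) u * ∏ j, u j ^ k n (Fin.succ b) j} ∩
        {u | |A n 0 u * ∏ j, u j ^ k n 0 j| ≤ t} with hCn
    have hC1 : IsClosed {u : Fin D → ℝ | ∀ b : ↥J,
        0 ≤ A n (Fin.succ b) u * ∏ j, u j ^ k n (Fin.succ b) j} := by
      rw [setOf_forall]
      exact isClosed_iInter fun b => isClosed_le continuous_const
        ((hAc n _).mul (continuous_finsetProd _ fun j _ => (continuous_apply j).pow _))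
    have hC2 : IsClosed {u : Fin D → ℝ | |A n 0 u * ∏ j, u j ^ k n 0 j| ≤ t} :=
      isClosed_le (continuous_abs.comp ((hAc n 0).mul
        (continuous_finsetProd _ fun j _ => (continuous_apply j).pow _))) continuous_const
    have hCnm : MeasurableSet Cn := (hC1.inter hC2).measurableSet
    have hset : {u ∈ ball (0 : Fin D → ℝ) (δ n) |
        (∀ b : ↥J, 0 ≤ A n (Fin.succ b) u * ∏ j, u j ^ k n (Fin.succ b) j) ∧
        |A n 0 u * ∏ j, u j ^ k n 0 j| ≤ t} = ball 0 (δ n) ∩ Cn := by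
      ext u; simp only [hCn, mem_inter_iff, mem_setOf_eq]
    rw [hset, ← setIntegral_indicator hCnm]
    refine setIntegral_congr_fun isOpen_ball.measurableSet fun u hu => ?_
    have hun : ‖u‖ ≤ δ n := (mem_ball_zero_iff.1 hu).le
    have hzU : Ψ (Pm n u) ∈ U := hPmU n u
    have hfz : |f (Ψ (Pm n u))| = |A n 0 u * ∏ j, u j ^ k n 0 j| := by
      rw [← hFam0, hmono n 0 u hun]
    have hgz : ∀ b : ↥J, g b (Ψ (Pm n u)) = A n (Fin.succ b) u * ∏ j, u j ^ k n (Fin.succ b) j :=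
      fun b => by rw [← hFamJ b b.2, hmono n _ u hun]
    have hzA : Ψ (Pm n u) ∈ Aset ↔ u ∈ Cn := by
      constructor
      · rintro ⟨⟨-, hgall⟩, hft⟩
        refine ⟨fun b => ?_, ?_⟩
        · rw [← hgz b]; exact hgall b
        · have : |f (Ψ (Pm n u))| ≤ t := hft
          rwa [hfz] at this
      · rintro ⟨hb, hft⟩
        refine ⟨⟨hzU, fun j => ?_⟩, ?_⟩
        · by_cases hj : j ∈ J
          · have := hb ⟨j, hj⟩; rwa [← hgz ⟨j, hj⟩] at this
          · exact hballJ _ (hPmball n u) j hj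
        · show |f (Ψ (Pm n u))| ≤ t
          rw [hfz]; exact hft
    by_cases huC : u ∈ Cn
    · rw [indicator_of_mem huC]
      have hzA' : Ψ (Pm n u) ∈ Aset := hzA.2 huC
      have hφz : max (φ (Ψ (Pm n u))) 0 = φ (Ψ (Pm n u)) := max_eq_left (hφpos _ hzA'.1).le
      simp only [hG, hGt, indicator_of_mem hzA', hφmU _ hzU, hρ, hφz]
      ring
    · rw [indicator_of_notMem huC]
      have hzA' : Ψ (Pm n u) ∉ Aset := fun h' => huC (hzA.1 h')
      simp only [hG, hGt, indicator_of_notMem hzA', zero_mul]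
  -- (v)+(vi) assemble
  calc ∫ z in Aset, σ z * φ z ∂μ = ∫ z, Gt z ∂μ := hLHS
    _ = c * ∑ n, ∫ u in ball (0 : Fin D → ℝ) (δ n),
          G (Pm n u) * (wt n u * (Jf n u * ∏ j, |u j| ^ h n j)) := hchain
    _ = c * ∑ n, ∑ i, ∫ y in {y | An n i y * ∏ j, y j ^ k n 0 j ≤ t},
          σ (Ψ (Pm n (Sn n i y))) * ψn n i y
            ∂(Measure.pi fun j => powMeasure (((h n j + 1 : ℕ) : ℝ))) := by
        congr 1
        refine Finset.sum_congr rfl fun n _ => ?_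
        rw [hchartform n]
        exact hidn n (fun u => σ (Ψ (Pm n u))) (hσc.comp (hΨc.comp (hPmc n))) t
    _ = ∑ p : (Σ n, ιn n), ∫ y in {y | An p.1 p.2 y * ∏ j, y j ^ k p.1 0 j ≤ t},
          σ (Ψ (Pm p.1 (Sn p.1 p.2 y))) * (c * ψn p.1 p.2 y)
            ∂(Measure.pi fun j => powMeasure (((h p.1 j + 1 : ℕ) : ℝ))) := by
        rw [Finset.mul_sum, Fintype.sum_sigma]
        refine Finset.sum_congr rfl fun n _ => ?_
        rw [Finset.mul_sum]
        refine Finset.sum_congr rfl fun i _ => ?_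
        rw [← integral_const_mul]
        exact integral_congr_ae (ae_of_all _ fun y => by ring)

/-- **`WilsonPartitionRegularVariation` from Hironaka's resolution of singularities** — the named
fact reduced to the PRINTED statement of the simultaneous real-analytic local resolution of
singularities (Watanabe 2009, Thm. 2.8 = Lin 2017, Thm. 2.2 + Cor. 2.3 = AGV II, Part II §6.3
Thm. 6.6 (Hironaka) for one function), everything else — Haar integral ↦ Laplace integral with
analytic phase, chart sum of the resolution, orthant pieces, elementary monomial asymptotics,
gluing, Abelian theorem — being proved in the tree. `hR` is NOT proved in the tree (Mathlib has no
resolution of singularities). [cite: WatanabeSumio2009, Thm. 2.8] [cite: Lin2017, Thm. 2.2, Cor. 2.3,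
Lemma 2.4, Thm. 2.9] [cite: ArnoldGuseinzadeVarchenko2012, Part II §6.3 Thm. 6.6, §7.3 Thm. 7.6] -/
theorem wilsonPartitionRegularVariation_of_resolutionOfSingularities
    (hR : ∀ (d l : ℕ) (V : Set (Fin d → ℝ)) (F : Fin l → (Fin d → ℝ) → ℝ),
      IsOpen V → IsPreconnected V → (0 : Fin d → ℝ) ∈ V →
      (∀ i, AnalyticOnNhd ℝ (F i) V) → (∀ i, F i 0 = 0) → (∀ i, ∃ v ∈ V, F i v ≠ 0) →
      ∃ (W : Set (Fin d → ℝ)) (M : Type) (_ : TopologicalSpace M) (_ : T2Space M)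
        (_ : ChartedSpace (Fin d → ℝ) M) (_ : IsManifold 𝓘(ℝ, Fin d → ℝ) ω M)
        (g : M → (Fin d → ℝ)),
        IsOpen W ∧ (0 : Fin d → ℝ) ∈ W ∧ W ⊆ V ∧ (∀ p, g p ∈ W) ∧
        ContMDiff 𝓘(ℝ, Fin d → ℝ) 𝓘(ℝ, Fin d → ℝ) ω g ∧
        (∀ K ⊆ W, IsCompact K → IsCompact (g ⁻¹' K)) ∧
        Set.BijOn g {p | ∀ i, F i (g p) ≠ 0} {x ∈ W | ∀ i, F i x ≠ 0} ∧
        ∀ p : M, (∃ i, F i (g p) = 0) →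
          ∃ φ : OpenPartialHomeomorph M (Fin d → ℝ),
            φ ∈ IsManifold.maximalAtlas 𝓘(ℝ, Fin d → ℝ) ω M ∧ p ∈ φ.source ∧ φ p = 0 ∧
            ∃ (k : Fin l → Fin d → ℕ) (h : Fin d → ℕ) (a : Fin l → (Fin d → ℝ) → ℝ)
              (b : (Fin d → ℝ) → ℝ),
              (∀ i, AnalyticOnNhd ℝ (a i) φ.target) ∧ AnalyticOnNhd ℝ b φ.target ∧
              (∀ i, ∀ u ∈ φ.target, a i u ≠ 0) ∧ (∀ u ∈ φ.target, b u ≠ 0) ∧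
              (∀ i, ∀ u ∈ φ.target, F i (g (φ.symm u)) = a i u * ∏ j, u j ^ k i j) ∧
              (∀ u ∈ φ.target, (fderiv ℝ (g ∘ φ.symm) u).det = b u * ∏ j, u j ^ h j)) :
    WilsonPartitionRegularVariation :=
  wilsonPartitionRegularVariation_of_localMonomialization (localMonomialization_of_resolution hR)

end Main

section Shape

/-- **Shape witness for the resolution hypothesis `hR`** (not the theorem): for `d = l = 1`,
`V = ℝ¹` and the coordinate function `F₀(v) = v₀` (smooth zero set, nothing to resolve) the
conclusion block of `hR` is inhabited by `M = ℝ¹`, `g = id`, `W = ℝ¹` and the identity chart with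
`F₀ ∘ g = 1 · u₀¹`, `det (g ∘ φ⁻¹)' = 1 · u⁰` — so the quantifier pattern of `hR` (manifold data as
anonymous-instance binders, maximal-atlas chart, monomial clauses) is consistent and not vacuous
junk. [folklore] -/
theorem resolutionHypothesis_shape_example :
    ∃ (W : Set (Fin 1 → ℝ)) (M : Type) (_ : TopologicalSpace M) (_ : T2Space M)
      (_ : ChartedSpace (Fin 1 → ℝ) M) (_ : IsManifold 𝓘(ℝ, Fin 1 → ℝ) ω M)
      (g : M → (Fin 1 → ℝ)),
      IsOpen W ∧ (0 : Fin 1 → ℝ) ∈ W ∧ W ⊆ univ ∧ (∀ p, g p ∈ W) ∧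
      ContMDiff 𝓘(ℝ, Fin 1 → ℝ) 𝓘(ℝ, Fin 1 → ℝ) ω g ∧
      (∀ K ⊆ W, IsCompact K → IsCompact (g ⁻¹' K)) ∧
      Set.BijOn g {p | ∀ i : Fin 1, (fun (_ : Fin 1) (v : Fin 1 → ℝ) => v 0) i (g p) ≠ 0}
        {x ∈ W | ∀ i : Fin 1, (fun (_ : Fin 1) (v : Fin 1 → ℝ) => v 0) i x ≠ 0} ∧
      ∀ p : M, (∃ i : Fin 1, (fun (_ : Fin 1) (v : Fin 1 → ℝ) => v 0) i (g p) = 0) →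
        ∃ φ : OpenPartialHomeomorph M (Fin 1 → ℝ),
          φ ∈ IsManifold.maximalAtlas 𝓘(ℝ, Fin 1 → ℝ) ω M ∧ p ∈ φ.source ∧ φ p = 0 ∧
          ∃ (k : Fin 1 → Fin 1 → ℕ) (h : Fin 1 → ℕ) (a : Fin 1 → (Fin 1 → ℝ) → ℝ)
            (b : (Fin 1 → ℝ) → ℝ),
            (∀ i, AnalyticOnNhd ℝ (a i) φ.target) ∧ AnalyticOnNhd ℝ b φ.target ∧
            (∀ i, ∀ u ∈ φ.target, a i u ≠ 0) ∧ (∀ u ∈ φ.target, b u ≠ 0) ∧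
            (∀ i, ∀ u ∈ φ.target, (fun (_ : Fin 1) (v : Fin 1 → ℝ) => v 0) i (g (φ.symm u)) =
              a i u * ∏ j, u j ^ k i j) ∧
            (∀ u ∈ φ.target, (fderiv ℝ (g ∘ φ.symm) u).det = b u * ∏ j, u j ^ h j) := by
  refine ⟨univ, (Fin 1 → ℝ), inferInstance, inferInstance, inferInstance, inferInstance, id,
    isOpen_univ, mem_univ _, subset_univ _, fun p => mem_univ _, contMDiff_id,
    fun K _ hK => by simpa using hK, ?_, fun p hp => ?_⟩
  · refine ⟨fun p hp => ⟨mem_univ _, hp⟩, injective_id.injOn, fun x hx => ⟨x, hx.2, rfl⟩⟩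
  · obtain ⟨i, hi⟩ := hp
    have hp0 : p = 0 := by
      funext j; rw [Subsingleton.elim j 0]; simpa using hi
    refine ⟨OpenPartialHomeomorph.refl (Fin 1 → ℝ), ?_, mem_univ _, by simpa using hp0,
      fun _ _ => 1, fun _ => 0, fun _ _ => 1, fun _ => 1, fun _ => analyticOnNhd_const,
      analyticOnNhd_const, fun _ u _ => one_ne_zero, fun u _ => one_ne_zero,
      fun i u _ => by simp, fun u _ => ?_⟩
    · simpa using IsManifold.chart_mem_maximalAtlas (I := 𝓘(ℝ, Fin 1 → ℝ)) (n := ω) p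
    · have : (id ∘ (OpenPartialHomeomorph.refl (Fin 1 → ℝ)).symm : (Fin 1 → ℝ) → (Fin 1 → ℝ)) = id := by
        funext u; rfl
      rw [this, fderiv_id]
      simp only [Finset.univ_unique, Fin.default_eq_zero, Fin.isValue, pow_zero,
        Finset.prod_const_one, mul_one]
      show LinearMap.det ((ContinuousLinearMap.id ℝ (Fin 1 → ℝ) : (Fin 1 → ℝ) →L[ℝ] (Fin 1 → ℝ)) :
        (Fin 1 → ℝ) →ₗ[ℝ] (Fin 1 → ℝ)) = 1
      rw [ContinuousLinearMap.coe_id, LinearMap.det_id]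

end Shape

end Literature.MathematicalPhysics.QuantumFieldTheory

end
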